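import Literature.Barriers.RiemannHypothesis.TuranMinWitnessLog
import HarnessLib

/-!
# Certified evaluation of `T(72 204 113 780 255)`: the hot loops

Barrier catalogue `Literature/Barriers/RiemannHypothesis/`, support file for the discharge of
`Literature.Barriers.RiemannHypothesis.BFM2008_thm1_minWitness`. Specifications of the three hot loops
of `TuranMinWitnessCalc.lean` and of the per-`d` evaluations built from them:

* `indivLoop_eq`, `runsLoop_eq`, `logLoop_eq` — what the loops compute, as exact integer sums;
* `sum_fiber_div` — the decomposition of `∑_{A<k≤B} F(k)` along the fibres of `k ↦ ⌊y/k⌋`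
  (runs of constant quotient), the combinatorial heart of the `O(√y)` run evaluation;
* `abs_indivTerm_sub_le`, `abs_runTerm_sub_le` — the real-number errors of one term / one run;
* `smallD_err` — `|smallD − 2^167 · (the small cell of d)| ≤ 2^120`;
* `logD_err` — the same for the log pieces (`≤ 2^115 (β+2)`), `segD_err` — for one `d` on one
  sieve segment.

## References

* [BorweinFergusonMossinghoff2008] P. Borwein, R. Ferguson, M. J. Mossinghoff, Math. Comp. 77
  (2008), 1681–1694, Thm. 1.
-/

open Finset ArithmeticFunction
open Literature.NumberTheory.LFunctions (LiouvilleSum.abs_liouville_le_one)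
open Literature.NumberTheory.LFunctions.LiouvilleSieve (segSieve pattern Q lamOf)
open Literature.Analysis.ValidatedNumerics.NumericsMP

namespace Literature.Barriers.RiemannHypothesis.TuranMinWitness

attribute [local irreducible] primesList Literature.NumberTheory.LFunctions.LiouvilleSieve.pattern
  Literature.NumberTheory.LFunctions.LiouvilleSieve.segSieve

/-! ## The exact term of the double sum -/

/-- The term of the double sum for `(y, m₀)`: `f(k) = (λ(k)/k) (H(⌊y/k⌋) − H(m₀))`. [folklore] -/
noncomputable def fterm (y m₀ k : ℕ) : ℝ := (liouville k : ℝ) / k * (Hn (y / k) - Hn m₀)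

/-! ## Runs of constant quotient -/

/-- `⌊y/k⌋ = w` iff `⌊y/(w+1)⌋ < k ≤ ⌊y/w⌋`, for `w, k ≥ 1`. [folklore] -/
theorem div_eq_iff_mem_run {y k w : ℕ} (hk : 0 < k) (hw : 0 < w) :
    y / k = w ↔ y / (w + 1) < k ∧ k ≤ y / w := by
  rw [Nat.div_lt_iff_lt_mul (Nat.succ_pos w), Nat.le_div_iff_mul_le hw]
  constructor
  · intro h
    subst h
    exact ⟨Nat.lt_mul_div_succ y hk, Nat.mul_div_le y k⟩
  · rintro ⟨h1, h2⟩
    exact Nat.div_eq_of_lt_le (by rw [mul_comm]; exact h2) (by rw [mul_comm]; exact h1)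

/-- **Fibre decomposition along `k ↦ ⌊y/k⌋`.** For `A < B ≤ y`:
`∑_{A<k≤B} F(k) = ∑_{⌊y/B⌋ ≤ w ≤ ⌊y/(A+1)⌋} ∑_{max(A,⌊y/(w+1)⌋) < k ≤ min(B,⌊y/w⌋)} F(k)`, and on the
inner range `⌊y/k⌋ = w`. [folklore] -/
theorem sum_fiber_div {M : Type*} [AddCommMonoid M] (F : ℕ → M) {y A B : ℕ} (hAB : A < B)
    (hBy : B ≤ y) :
    ∑ k ∈ Ioc A B, F k =
      ∑ w ∈ Ioc (y / B - 1) (y / (A + 1)), ∑ k ∈ Ioc (max A (y / (w + 1))) (min B (y / w)), F k := by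
  have hyB : 1 ≤ y / B := (Nat.le_div_iff_mul_le (by omega)).2 (by simpa using hBy)
  rw [← sum_fiberwise_of_maps_to (s := Ioc A B) (t := Ioc (y / B - 1) (y / (A + 1)))
    (g := fun k => y / k) (f := F)]
  · refine sum_congr rfl fun w hw => ?_
    obtain ⟨hw1, hw2⟩ := mem_Ioc.1 hw
    have hw0 : 0 < w := by omega
    congr 1
    ext k
    simp only [mem_filter, mem_Ioc, max_lt_iff, le_min_iff]
    constructor
    · rintro ⟨⟨hAk, hkB⟩, hk⟩
      have hk0 : 0 < k := by omega
      have := (div_eq_iff_mem_run hk0 hw0).1 hk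
      exact ⟨⟨hAk, this.1⟩, hkB, this.2⟩
    · rintro ⟨⟨hAk, h1⟩, hkB, h2⟩
      have hk0 : 0 < k := by omega
      exact ⟨⟨hAk, hkB⟩, (div_eq_iff_mem_run hk0 hw0).2 ⟨h1, h2⟩⟩
  · intro k hk
    obtain ⟨hAk, hkB⟩ := mem_Ioc.1 hk
    rw [mem_Ioc]
    constructor
    · have : y / B ≤ y / k := Nat.div_le_div_left hkB (by omega)
      omega
    · exact Nat.div_le_div_left (by omega) (by omega)

/-! ## The individual loop -/

/-- The integer term of the individual loop. [folklore] -/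
def indivTerm (y hm : ℕ) (h : Array ℕ) (k : ℕ) : ℕ := ((h[y / k]! - hm) <<< SI) / k

/-- **What `indivLoop` computes**: `accP − accN + ∑_{k<k'≤kb} λbit(k') · indivTerm(k')`. [folklore] -/
theorem indivLoop_eq (y hm : ℕ) (h : Array ℕ) (lam : Array Bool) :
    ∀ (n k kb : ℕ) (accP accN : ℕ), kb - k = n →
      ((indivLoop y hm h lam k kb accP accN).1 : ℤ) - (indivLoop y hm h lam k kb accP accN).2 =
        (accP : ℤ) - accN + ∑ k' ∈ Ioc k kb, lamOfBit lam k' * (indivTerm y hm h k' : ℤ) := by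
  intro n
  induction n with
  | zero =>
    intro k kb accP accN hn
    rw [indivLoop, if_neg (by omega)]
    simp [Finset.Ioc_eq_empty (by omega : ¬ k < kb)]
  | succ n ih =>
    intro k kb accP accN hn
    rw [indivLoop, if_pos (by omega)]
    simp only
    have hsplit : ∑ k' ∈ Ioc k kb, lamOfBit lam k' * (indivTerm y hm h k' : ℤ) =
        lamOfBit lam (k + 1) * (indivTerm y hm h (k + 1) : ℤ) +
          ∑ k' ∈ Ioc (k + 1) kb, lamOfBit lam k' * (indivTerm y hm h k' : ℤ) := by
      rw [← sum_Ioc_consecutive _ (Nat.le_succ k) (by omega : k + 1 ≤ kb), Nat.Ioc_succ_singleton,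
        sum_singleton]
    rw [hsplit]
    split_ifs with hb
    · rw [ih (k + 1) kb _ _ (by omega)]
      have e : lamOfBit lam (k + 1) = 1 := by simp [lamOfBit, hb]
      rw [e, indivTerm]; push_cast; ring
    · rw [ih (k + 1) kb _ _ (by omega)]
      have e : lamOfBit lam (k + 1) = -1 := by simp [lamOfBit, hb]
      rw [e, indivTerm]; push_cast; ring

/-- **Error of one individual term**: with the harmonic table correct and `m₀ < w = ⌊y/k⌋ ≤ W`,
`|λ(k)·t − 2^90 f(k)| ≤ 1 + 2^34/k`. [folklore] -/
theorem abs_indivTerm_sub_le {W : ℕ} (hW : W < 2 ^ 33) {y m₀ k : ℕ} (hk : 0 < k)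
    (hm : m₀ ≤ y / k) (hw : y / k ≤ W) :
    |(liouville k : ℝ) * (indivTerm y ((htab W)[m₀]!) (htab W) k : ℕ) -
        2 ^ (SH + SI) * fterm y m₀ k| ≤ 1 + 2 ^ (SI + 1) / k := by
  have hmW : m₀ ≤ W := hm.trans hw
  obtain ⟨h1, h2⟩ := htab_real W hW hw
  obtain ⟨h3, h4⟩ := htab_real W hW hmW
  have hmono := htab_mono W hm hw
  set hwv := (htab W)[y / k]! with hhwv
  set hmv := (htab W)[m₀]! with hhmv
  set g : ℕ := hwv - hmv with hg
  have hgr : (g : ℝ) = (hwv : ℝ) - hmv := by rw [hg, Nat.cast_sub hmono]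
  -- `|g − 2^57 G| ≤ 2`
  set G := Hn (y / k) - Hn m₀ with hG
  have hgG : |(g : ℝ) - 2 ^ SH * G| ≤ 2 := by
    rw [hgr, hG, abs_le]; constructor <;> nlinarith
  -- the term
  have hkr : (0 : ℝ) < k := by exact_mod_cast hk
  set q : ℕ := (g <<< SI) / k with hq
  have hqeq : indivTerm y hmv (htab W) k = q := by rw [indivTerm, hq, hg]
  rw [hqeq]
  have hgs : ((g <<< SI : ℕ) : ℝ) = g * 2 ^ SI := by rw [Nat.shiftLeft_eq]; push_cast; ring
  have hq1 : (q : ℝ) * k ≤ g * 2 ^ SI := by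
    rw [← hgs]; exact_mod_cast Nat.div_mul_le_self _ _
  have hq2 : (g : ℝ) * 2 ^ SI < q * k + k := by
    rw [← hgs]; exact_mod_cast Nat.lt_div_mul_add hk
  have hA : (q : ℝ) ≤ g * 2 ^ SI / k := by rw [le_div_iff₀ hkr]; exact hq1
  have hB : (g : ℝ) * 2 ^ SI / k < q + 1 := by rw [div_lt_iff₀ hkr]; linarith
  -- `|q − 2^90 G / k| ≤ 1 + 2^34/k`
  have hmain : |(q : ℝ) - 2 ^ (SH + SI) * G / k| ≤ 1 + 2 ^ (SI + 1) / k := by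
    have e1 : (2 : ℝ) ^ (SH + SI) * G / k = (2 ^ SH * G) * 2 ^ SI / k := by rw [pow_add]; ring
    rw [e1]
    have hd : |(g : ℝ) * 2 ^ SI / k - 2 ^ SH * G * 2 ^ SI / k| ≤ 2 ^ (SI + 1) / k := by
      rw [← sub_div, ← sub_mul, abs_div, abs_of_pos hkr, div_le_div_iff_of_pos_right hkr, abs_mul,
        abs_of_pos (by positivity : (0:ℝ) < 2 ^ SI), pow_succ]
      calc |(g : ℝ) - 2 ^ SH * G| * 2 ^ SI ≤ 2 * 2 ^ SI := mul_le_mul_of_nonneg_right hgG (by positivity)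
        _ = 2 ^ SI * 2 := by ring
    have hd2 : |(q : ℝ) - g * 2 ^ SI / k| ≤ 1 := by rw [abs_le]; constructor <;> linarith
    calc |(q : ℝ) - 2 ^ SH * G * 2 ^ SI / k|
        = |((q : ℝ) - g * 2 ^ SI / k) + (g * 2 ^ SI / k - 2 ^ SH * G * 2 ^ SI / k)| := by ring_nf
      _ ≤ |(q : ℝ) - g * 2 ^ SI / k| + |(g : ℝ) * 2 ^ SI / k - 2 ^ SH * G * 2 ^ SI / k| :=
          abs_add_le _ _
      _ ≤ 1 + 2 ^ (SI + 1) / k := by linarith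
  -- multiply by `λ(k) = ±1`
  have hl : (liouville k : ℝ) = 1 ∨ (liouville k : ℝ) = -1 := by
    rw [ArithmeticFunction.liouville_apply hk.ne']
    rcases neg_one_pow_eq_or ℤ (cardFactors k) with h | h <;> rw [h] <;> simp
  have ef : 2 ^ (SH + SI) * fterm y m₀ k = (liouville k : ℝ) * (2 ^ (SH + SI) * G / k) := by
    rw [fterm, hG]; ring
  rw [ef]
  rcases hl with hl | hl <;> rw [hl]
  · simpa using hmain
  · have e2 : (-1 : ℝ) * q - -1 * (2 ^ (SH + SI) * G / k) = -((q : ℝ) - 2 ^ (SH + SI) * G / k) := by ring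
    rw [e2, abs_neg]; exact hmain

/-! ## The runs loop -/

/-- The integer contribution of one run (as computed). [folklore] -/
def runTerm (y hm lo A B : ℕ) (h : Array ℕ) (t : Array ℤ) (w : ℕ) : ℤ :=
  if max A (y / (w + 1)) < min B (y / w) then
    ((h[w]! - hm : ℕ) : ℤ) * (t[min B (y / w) + 1 - lo]! - t[max A (y / (w + 1)) + 1 - lo]!)
  else 0

/-- **What `runsLoop` computes**: `acc + ∑_{w<w'≤wb} runTerm(w')`. [folklore] -/
theorem runsLoop_eq (y hm lo A B : ℕ) (h : Array ℕ) (t : Array ℤ) :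
    ∀ (n w wb : ℕ) (acc : ℤ), wb - w = n →
      runsLoop y hm lo A B h t w wb acc = acc + ∑ w' ∈ Ioc w wb, runTerm y hm lo A B h t w' := by
  intro n
  induction n with
  | zero =>
    intro w wb acc hn
    rw [runsLoop, if_neg (by omega)]
    simp [Finset.Ioc_eq_empty (by omega : ¬ w < wb)]
  | succ n ih =>
    intro w wb acc hn
    rw [runsLoop, if_pos (by omega)]
    simp only
    rw [ih (w + 1) wb _ (by omega), ← sum_Ioc_consecutive _ (Nat.le_succ w) (by omega : w + 1 ≤ wb),
      Nat.Ioc_succ_singleton, sum_singleton, runTerm]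
    split_ifs <;> ring

/-- The exact value of one run: `∑_{k in the run} f(k) = (H(w) − H(m₀)) (T(kHi) − T(kLo))`.
[folklore] -/
theorem sum_run_fterm {y m₀ w : ℕ} {kLo kHi : ℕ} (hle : kLo ≤ kHi)
    (hrun : ∀ k ∈ Ioc kLo kHi, y / k = w) :
    ∑ k ∈ Ioc kLo kHi, fterm y m₀ k = (Hn w - Hn m₀) * (Tn kHi - Tn kLo) := by
  rw [Tn_sub_Tn hle, mul_sum]
  refine sum_congr rfl fun k hk => ?_
  rw [fterm, hrun k hk]; ring

/-- **Error of one run**: with `g = h[w] − h[m₀]` (`m₀ ≤ w ≤ W`) and `kLo ≤ kHi`,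
`|g · (τ(kHi) − τ(kLo)) − 2^167 (H(w) − H(m₀))(T(kHi) − T(kLo))|`
`  ≤ 17·2^57 (kHi − kLo) + 2^111 (H(kHi) − H(kLo))` provided `H(W) < 17`. [folklore] -/
theorem abs_runTerm_sub_le {W : ℕ} (hW : W < 2 ^ 33) (hH : Hn W < 17) {m₀ w : ℕ} (hm : m₀ ≤ w)
    (hwW : w ≤ W) {kLo kHi : ℕ} (hle : kLo ≤ kHi) :
    |(((htab W)[w]! - (htab W)[m₀]! : ℕ) : ℝ) * ((tau kHi - tau kLo : ℤ) : ℝ) -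
        2 ^ SR * ((Hn w - Hn m₀) * (Tn kHi - Tn kLo))| ≤
      17 * 2 ^ SH * (kHi - kLo : ℕ) + 2 ^ (ST + 1) * (Hn kHi - Hn kLo) := by
  have hmW : m₀ ≤ W := hm.trans hwW
  obtain ⟨h1, h2⟩ := htab_real W hW hwW
  obtain ⟨h3, h4⟩ := htab_real W hW hmW
  obtain ⟨h5, h6⟩ := htab_real W hW le_rfl
  have hmono := htab_mono W hm hwW
  have hmono2 := htab_mono W hwW le_rfl
  set g : ℕ := (htab W)[w]! - (htab W)[m₀]! with hg
  have hgr : (g : ℝ) = ((htab W)[w]! : ℝ) - (htab W)[m₀]! := by rw [hg, Nat.cast_sub hmono]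
  set G := Hn w - Hn m₀ with hG
  have hgG : |(g : ℝ) - 2 ^ SH * G| ≤ 2 := by rw [hgr, hG, abs_le]; constructor <;> nlinarith
  have hg0 : (0 : ℝ) ≤ g := by positivity
  have hgle : (g : ℝ) ≤ 17 * 2 ^ SH := by
    have hz : ((htab W)[m₀]! : ℝ) ≥ 0 := by positivity
    have hmono2' : ((htab W)[w]! : ℝ) ≤ (htab W)[W]! := by exact_mod_cast hmono2
    have h7 : (2 : ℝ) ^ SH * Hn W ≤ 2 ^ SH * 17 := by gcongr
    linarith
  have hτ := abs_tauDiff_le hle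
  set Δτ : ℝ := ((tau kHi - tau kLo : ℤ) : ℝ) with hΔτ
  set ΔT := Tn kHi - Tn kLo with hΔT
  have hΔT : |ΔT| ≤ Hn kHi - Hn kLo := abs_Tn_sub_Tn_le hle
  have e : (g : ℝ) * Δτ - 2 ^ SR * (G * ΔT) =
      (g : ℝ) * (Δτ - 2 ^ ST * ΔT) + 2 ^ ST * ΔT * ((g : ℝ) - 2 ^ SH * G) := by
    rw [show (SR : ℕ) = ST + SH by rfl, pow_add]; ring
  rw [e]
  calc |(g : ℝ) * (Δτ - 2 ^ ST * ΔT) + 2 ^ ST * ΔT * ((g : ℝ) - 2 ^ SH * G)|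
      ≤ |(g : ℝ) * (Δτ - 2 ^ ST * ΔT)| + |2 ^ ST * ΔT * ((g : ℝ) - 2 ^ SH * G)| := abs_add_le _ _
    _ = (g : ℝ) * |Δτ - 2 ^ ST * ΔT| + 2 ^ ST * |ΔT| * |(g : ℝ) - 2 ^ SH * G| := by
        rw [abs_mul, abs_of_nonneg hg0, abs_mul, abs_mul, abs_of_pos (by positivity : (0:ℝ) < 2 ^ ST)]
    _ ≤ 17 * 2 ^ SH * (kHi - kLo : ℕ) + 2 ^ ST * (Hn kHi - Hn kLo) * 2 := by
        refine add_le_add (mul_le_mul hgle hτ (abs_nonneg _) (by positivity)) ?_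
        have hHn : 0 ≤ Hn kHi - Hn kLo := sub_nonneg.2 (Hn_mono hle)
        refine mul_le_mul (mul_le_mul_of_nonneg_left hΔT (by positivity)) hgG (abs_nonneg _) ?_
        exact mul_nonneg (by positivity) hHn
    _ = 17 * 2 ^ SH * (kHi - kLo : ℕ) + 2 ^ (ST + 1) * (Hn kHi - Hn kLo) := by rw [pow_succ]; ring

/-! ## The log loop -/

/-- The integer term of the log loop. [folklore] -/
def logTerm (d : ℕ) (hm : ℤ) (hl : Array ℕ) (k : ℕ) : ℤ := (((hl[d * k]! : ℤ) - hm) * 2 ^ SI) / (k : ℤ)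

/-- **What `logLoop` computes**: `acc + ∑_{k<k'≤kb} λbit(k') · logTerm(k')`. [folklore] -/
theorem logLoop_eq (d : ℕ) (hm : ℤ) (hl : Array ℕ) (lam : Array Bool) :
    ∀ (n k kb : ℕ) (acc : ℤ), kb - k = n →
      logLoop d hm hl lam k kb acc = acc + ∑ k' ∈ Ioc k kb, lamOfBit lam k' * logTerm d hm hl k' := by
  intro n
  induction n with
  | zero =>
    intro k kb acc hn
    rw [logLoop, if_neg (by omega)]
    simp [Finset.Ioc_eq_empty (by omega : ¬ k < kb)]
  | succ n ih =>
    intro k kb acc hn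
    rw [logLoop, if_pos (by omega)]
    simp only
    rw [ih (k + 1) kb _ (by omega), ← sum_Ioc_consecutive _ (Nat.le_succ k) (by omega : k + 1 ≤ kb),
      Nat.Ioc_succ_singleton, sum_singleton, lamOfBit, logTerm]
    split_ifs <;> ring

/-- **Error of one log term**: with `hl[dk] ≤ 2^57 H(⌊N/(dk)⌋) < hl[dk] + β + 1` (`HlogOK`) and the
harmonic table correct at `m₀ ≤ W`:
`|λ(k)·logTerm − 2^90 λ(k)(H(⌊N/(dk)⌋) − H(m₀))/k| ≤ 1 + 2^33 (β+1)/k`. [folklore] -/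
theorem abs_logTerm_sub_le {W : ℕ} (hW : W < 2 ^ 33) {N β d m₀ k : ℕ} (hk : 0 < k) (hmW : m₀ ≤ W)
    {hl : Array ℕ} {v : ℕ} (hv : hl[d * k]? = some v) (hok : HlogOK N β v (d * k)) (hβ : 1 ≤ β) :
    |(liouville k : ℝ) * (logTerm d ((htab W)[m₀]! : ℤ) hl k : ℤ) -
        2 ^ (SH + SI) * ((liouville k : ℝ) / k * (Hn (N / (d * k)) - Hn m₀))| ≤
      1 + 2 ^ SI * (β + 1) / k := by
  obtain ⟨h3, h4⟩ := htab_real W hW hmW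
  obtain ⟨h1, h2⟩ := hok
  have hvv : hl[d * k]! = v := getElem!_of_getElem? hv
  set g : ℤ := (v : ℤ) - ((htab W)[m₀]! : ℤ) with hg
  set G := Hn (N / (d * k)) - Hn m₀ with hG
  have hβr : (1 : ℝ) ≤ β := by exact_mod_cast hβ
  have hgG : |(g : ℝ) - 2 ^ SH * G| ≤ β + 1 := by
    rw [hg, hG, abs_le]; push_cast; constructor <;> nlinarith
  have hkr : (0 : ℝ) < k := by exact_mod_cast hk
  have hkz : (0 : ℤ) < k := by exact_mod_cast hk
  set q : ℤ := (g * 2 ^ SI) / (k : ℤ) with hq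
  have hqeq : logTerm d ((htab W)[m₀]! : ℤ) hl k = q := by rw [logTerm, hvv]
  rw [hqeq]
  have hq1 : (q : ℝ) * k ≤ g * 2 ^ SI := by
    have := Int.ediv_mul_le (g * 2 ^ SI) hkz.ne'
    exact_mod_cast this
  have hq2 : (g : ℝ) * 2 ^ SI < q * k + k := by
    have h0 := Int.lt_ediv_add_one_mul_self (g * 2 ^ SI) hkz
    have h0' : ((g * 2 ^ SI : ℤ) : ℝ) < (((g * 2 ^ SI / k + 1) * k : ℤ) : ℝ) := by exact_mod_cast h0
    push_cast at h0'
    have : (q : ℝ) = ((g * 2 ^ SI / k : ℤ) : ℝ) := by rw [hq]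
    rw [this]; linarith
  have hA : (q : ℝ) ≤ g * 2 ^ SI / k := by rw [le_div_iff₀ hkr]; exact hq1
  have hB : (g : ℝ) * 2 ^ SI / k < q + 1 := by rw [div_lt_iff₀ hkr]; linarith
  have hmain : |(q : ℝ) - 2 ^ (SH + SI) * G / k| ≤ 1 + 2 ^ SI * (β + 1) / k := by
    have e1 : (2 : ℝ) ^ (SH + SI) * G / k = (2 ^ SH * G) * 2 ^ SI / k := by rw [pow_add]; ring
    rw [e1]
    have hd : |(g : ℝ) * 2 ^ SI / k - 2 ^ SH * G * 2 ^ SI / k| ≤ 2 ^ SI * (β + 1) / k := by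
      rw [← sub_div, ← sub_mul, abs_div, abs_of_pos hkr, div_le_div_iff_of_pos_right hkr, abs_mul,
        abs_of_pos (by positivity : (0:ℝ) < 2 ^ SI)]
      calc |(g : ℝ) - 2 ^ SH * G| * 2 ^ SI ≤ (β + 1) * 2 ^ SI := mul_le_mul_of_nonneg_right hgG (by positivity)
        _ = 2 ^ SI * (β + 1) := by ring
    have hd2 : |(q : ℝ) - g * 2 ^ SI / k| ≤ 1 := by rw [abs_le]; constructor <;> linarith
    calc |(q : ℝ) - 2 ^ SH * G * 2 ^ SI / k|
        = |((q : ℝ) - g * 2 ^ SI / k) + (g * 2 ^ SI / k - 2 ^ SH * G * 2 ^ SI / k)| := by ring_nf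
      _ ≤ |(q : ℝ) - g * 2 ^ SI / k| + |(g : ℝ) * 2 ^ SI / k - 2 ^ SH * G * 2 ^ SI / k| :=
          abs_add_le _ _
      _ ≤ 1 + 2 ^ SI * (β + 1) / k := by linarith
  have hl : (liouville k : ℝ) = 1 ∨ (liouville k : ℝ) = -1 := by
    rw [ArithmeticFunction.liouville_apply hk.ne']
    rcases neg_one_pow_eq_or ℤ (cardFactors k) with h | h <;> rw [h] <;> simp
  have ef : 2 ^ (SH + SI) * ((liouville k : ℝ) / k * G) = (liouville k : ℝ) * (2 ^ (SH + SI) * G / k) := by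
    ring
  rw [ef]
  rcases hl with hl | hl <;> rw [hl]
  · simpa using hmain
  · have e2 : (-1 : ℝ) * q - -1 * (2 ^ (SH + SI) * G / k) = -((q : ℝ) - 2 ^ (SH + SI) * G / k) := by ring
    rw [e2, abs_neg]; exact hmain

/-! ## Summed errors -/

/-- `∑_{a<k≤b} 1/k = H(b) − H(a)` (as used for the error sums). [folklore] -/
theorem sum_Ioc_inv {a b : ℕ} (h : a ≤ b) : ∑ k ∈ Ioc a b, (1 : ℝ) / k = Hn b - Hn a :=
  (Hn_sub_Hn h).symm

/-- **The individual loop, summed error**: for a range `(c, c']` on which `m₀ ≤ ⌊y/k⌋ ≤ W` and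
`1 ≤ k ≤ W` (bit table valid),
`|(accP − accN) − 2^90 ∑ f| ≤ (c' − c) + 2^34 (H(c') − H(c))`. [folklore] -/
theorem indiv_err {W : ℕ} (hWQ : W + Q ≤ P ^ 2) (hW : W < 2 ^ 33) {y m₀ c c' : ℕ} (hcc : c ≤ c')
    (hc' : c' ≤ W) (hfib : ∀ k ∈ Ioc c c', m₀ ≤ y / k ∧ y / k ≤ W) :
    let a := indivLoop y ((htab W)[m₀]!) (htab W) (lamBits (pattern Q) W) c c' 0 0
    |((a.1 : ℤ) - a.2 : ℝ) - 2 ^ (SH + SI) * ∑ k ∈ Ioc c c', fterm y m₀ k| ≤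
      (c' - c : ℕ) + 2 ^ (SI + 1) * (Hn c' - Hn c) := by
  intro a
  have heq := indivLoop_eq y ((htab W)[m₀]!) (htab W) (lamBits (pattern Q) W) (c' - c) c c' 0 0 rfl
  simp only [Nat.cast_zero, sub_zero, zero_add] at heq
  have hcast : (((a.1 : ℤ) - a.2 : ℤ) : ℝ) = ((a.1 : ℤ) - a.2 : ℝ) := by push_cast; ring
  rw [← hcast, heq, Int.cast_sum, mul_sum, ← sum_sub_distrib]
  have hcard : ((c' - c : ℕ) : ℝ) = ∑ k ∈ Ioc c c', (1 : ℝ) := by simp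
  rw [hcard, ← sum_Ioc_inv hcc, mul_sum, ← sum_add_distrib]
  refine (abs_sum_le_sum_abs _ _).trans (sum_le_sum fun k hk => ?_)
  obtain ⟨hk1, hk2⟩ := mem_Ioc.1 hk
  have hk0 : 0 < k := by omega
  obtain ⟨hm, hw⟩ := hfib k hk
  rw [lamOfBit_lamBits hWQ hk0 (hk2.trans hc')]
  have := abs_indivTerm_sub_le hW hk0 hm hw
  rw [indivTerm] at this
  push_cast at this ⊢
  rw [mul_one_div]
  exact this

/-- **The runs loop, summed error.** For `A < B ≤ y`, a table `t` holding `τ`-differences from `lo`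
on `[A, B]`, and fibres on which `m₀ ≤ ⌊y/k⌋ ≤ W`:
`|runsLoop … (⌊y/B⌋−1) ⌊y/(A+1)⌋ 0 − 2^167 ∑_{A<k≤B} f| ≤ 17·2^57 (B − A) + 2^111 (H(B) − H(A))`.
[folklore] -/
theorem runs_err {W : ℕ} (hW : W < 2 ^ 33) (hH : Hn W < 17) {y m₀ lo A B : ℕ} (hAB : A < B)
    (hBy : B ≤ y) (hfib : ∀ k ∈ Ioc A B, m₀ ≤ y / k ∧ y / k ≤ W) {t : Array ℤ}
    (ht : ∀ kLo kHi, A ≤ kLo → kLo ≤ kHi → kHi ≤ B →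
      t[kHi + 1 - lo]! - t[kLo + 1 - lo]! = tau kHi - tau kLo) :
    |(runsLoop y ((htab W)[m₀]!) lo A B (htab W) t (y / B - 1) (y / (A + 1)) 0 : ℝ) -
        2 ^ SR * ∑ k ∈ Ioc A B, fterm y m₀ k| ≤
      17 * 2 ^ SH * (B - A : ℕ) + 2 ^ (ST + 1) * (Hn B - Hn A) := by
  rw [runsLoop_eq y _ lo A B (htab W) t _ (y / B - 1) (y / (A + 1)) 0 rfl, zero_add,
    sum_fiber_div (fterm y m₀) hAB hBy, Int.cast_sum, mul_sum, ← sum_sub_distrib]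
  -- the bound, fibrewise
  have hcard : ((B - A : ℕ) : ℝ) = ∑ k ∈ Ioc A B, (1 : ℝ) := by simp
  rw [hcard, ← sum_Ioc_inv hAB.le, sum_fiber_div (fun _ => (1 : ℝ)) hAB hBy,
    sum_fiber_div (fun k => (1 : ℝ) / k) hAB hBy, mul_sum, mul_sum, ← sum_add_distrib]
  refine (abs_sum_le_sum_abs _ _).trans (sum_le_sum fun w hw => ?_)
  obtain ⟨hw1, hw2⟩ := mem_Ioc.1 hw
  set kLo := max A (y / (w + 1)) with hkLo
  set kHi := min B (y / w) with hkHi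
  have hw0 : 0 < w := by
    have hyB : 1 ≤ y / B := (Nat.le_div_iff_mul_le (by omega)).2 (by simpa using hBy)
    omega
  rw [runTerm]
  by_cases hlt : kLo < kHi
  · rw [if_pos hlt]
    -- the fibre is nonempty: pick `k = kHi`
    have hkHiA : A < kHi := lt_of_le_of_lt (le_max_left _ _) hlt
    have hkHiB : kHi ≤ B := min_le_left _ _
    have hmemHi : kHi ∈ Ioc A B := mem_Ioc.2 ⟨hkHiA, hkHiB⟩
    have hdiv : y / kHi = w :=
      (div_eq_iff_mem_run (by omega) hw0).2 ⟨lt_of_le_of_lt (le_max_right _ _) hlt, min_le_right _ _⟩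
    obtain ⟨hm, hwW⟩ := hfib kHi hmemHi
    rw [hdiv] at hm hwW
    have hrun : ∀ k ∈ Ioc kLo kHi, y / k = w := fun k hk => by
      obtain ⟨h1, h2⟩ := mem_Ioc.1 hk
      exact (div_eq_iff_mem_run (by omega) hw0).2
        ⟨lt_of_le_of_lt (le_max_right _ _) h1, h2.trans (min_le_right _ _)⟩
    rw [sum_run_fterm hlt.le hrun, ht kLo kHi (le_max_left _ _) hlt.le hkHiB]
    have key := abs_runTerm_sub_le hW hH hm hwW hlt.le (m₀ := m₀)
    have e1 : ∑ k ∈ Ioc kLo kHi, (1 : ℝ) = (kHi - kLo : ℕ) := by simp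
    rw [e1, sum_Ioc_inv hlt.le]
    push_cast at key ⊢
    exact key
  · rw [if_neg hlt]
    have hempty : Ioc kLo kHi = ∅ := Finset.Ioc_eq_empty hlt
    rw [hempty]
    simp

/-! ## The small cell of one `d` -/

/-- The cuts of the small cell: `cut nLog d = min kmax ⌊E₀/d⌋`, `cut (nLog+1) d = min kmax W`.
[folklore] -/
theorem cut_nLog (p : Params) (d : ℕ) :
    p.cut p.nLog d = min (p.kmax d) (p.E0 / d) ∧ p.cut (p.nLog + 1) d = min (p.kmax d) p.W := by
  unfold Params.cut Params.rawCut Params.ell Params.nLog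
  constructor
  · rw [if_pos le_rfl, if_neg (by omega), if_neg (by omega)]
  · rw [if_neg (by omega), if_pos rfl]

/-- `kmax(d) ≤ y_d`. [folklore] -/
theorem kmax_le_y (p : Params) (d : ℕ) : p.kmax d ≤ p.y d := Nat.div_le_self _ _

/-- On the small/sieve ranges the quotient `⌊y_d/k⌋` lies in `[m₀+1, W]`: for `⌊E₀/d⌋ < k ≤ kmax(d)`
(and `1 ≤ d`), `m₀(d) + 1 ≤ ⌊y_d/k⌋ ≤ W`. [folklore] -/
theorem quot_bounds (p : Params) {d k : ℕ} (hd : 1 ≤ d) (hk1 : p.E0 / d < k) (hk2 : k ≤ p.kmax d) :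
    p.m0 d + 1 ≤ p.y d / k ∧ p.y d / k ≤ p.W := by
  have hk0 : 0 < k := lt_of_le_of_lt (Nat.zero_le _) hk1
  constructor
  · rw [Nat.le_div_iff_mul_le hk0]
    have := (Nat.le_div_iff_mul_le (Nat.succ_pos _)).1 hk2
    linarith
  · -- `d k ≥ E₀ + 1`, hence `N < (W+1) d k` and `y/k = N/(dk) ≤ W`
    have hdk : p.E0 + 1 ≤ d * k := by
      have h1 : p.E0 < p.E0 / d * d + d := Nat.lt_div_mul_add hd
      have h2 : p.E0 / d * d + d = d * (p.E0 / d + 1) := by ring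
      have h3 : d * (p.E0 / d + 1) ≤ d * k := Nat.mul_le_mul_left d hk1
      omega
    have hN : p.N < (p.W + 1) * (d * k) := by
      have h1 : p.N < p.N / (p.W + 1) * (p.W + 1) + (p.W + 1) := Nat.lt_div_mul_add (Nat.succ_pos _)
      have h2 : p.N / (p.W + 1) * (p.W + 1) + (p.W + 1) = (p.W + 1) * (p.E0 + 1) := by
        rw [Params.E0]; ring
      have h3 : (p.W + 1) * (p.E0 + 1) ≤ (p.W + 1) * (d * k) := Nat.mul_le_mul_left _ hdk
      omega
    rw [Params.y, Nat.div_div_eq_div_mul]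
    exact Nat.le_of_lt_succ ((Nat.div_lt_iff_lt_mul (by positivity)).2 hN)

/-- **Error of the small cell of one `d`**: `|smallD − 2^167 ∑_{cut nLog < k ≤ cut (nLog+1)} f| ≤ 2^120`.
[folklore] -/
theorem smallD_err (p : Params) (hWQ : p.W + Q ≤ P ^ 2) (hW : p.W < 2 ^ 33) (hH : Hn p.W < 17)
    {d : ℕ} (hd : 1 ≤ d) :
    |(smallD p (htab p.W) (lamBits (pattern Q) p.W) (tPre (lamBits (pattern Q) p.W) p.W) d : ℝ) -
        2 ^ SR * ∑ k ∈ Ioc (p.cut p.nLog d) (p.cut (p.nLog + 1) d), fterm (p.y d) (p.m0 d) k| ≤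
      smallErr := by
  obtain ⟨hc1, hc2⟩ := cut_nLog p d
  set c1 := p.cut p.nLog d with hc1d
  set c2 := p.cut (p.nLog + 1) d with hc2d
  set y := p.y d with hy
  set m₀ := p.m0 d with hm₀
  have hErr : (smallErr : ℝ) = 2 ^ 120 := by rw [smallErr]; norm_num
  unfold smallD
  simp only [← hc1d, ← hc2d, ← hy, ← hm₀]
  by_cases hle : c2 ≤ c1
  · rw [if_pos hle, Finset.Ioc_eq_empty (not_lt.2 hle)]
    simp [hErr]
  rw [if_neg hle]
  push Not at hle
  have hc2k : c2 ≤ p.kmax d := by rw [hc2]; exact min_le_left _ _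
  have hc2W : c2 ≤ p.W := by rw [hc2]; exact min_le_right _ _
  have hc2y : c2 ≤ y := hc2k.trans (kmax_le_y p d)
  have hc1E : p.E0 / d ≤ c1 := by
    rw [hc1]
    rcases Nat.lt_or_ge (p.E0 / d) (p.kmax d) with h | h
    · rw [min_eq_right h.le]
    · exfalso
      have : c1 = p.kmax d := by rw [hc1]; exact min_eq_left h
      omega
  -- quotient bounds on the whole range
  have hfib : ∀ k ∈ Ioc c1 c2, m₀ ≤ y / k ∧ y / k ≤ p.W := fun k hk => by
    obtain ⟨h1, h2⟩ := mem_Ioc.1 hk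
    have := quot_bounds p hd (lt_of_le_of_lt hc1E h1) (h2.trans hc2k)
    exact ⟨Nat.le_of_succ_le this.1, this.2⟩
  set ks := min c2 (max c1 (Nat.sqrt y)) with hks
  have hks1 : c1 ≤ ks := le_min hle.le (le_max_left _ _)
  have hks2 : ks ≤ c2 := min_le_left _ _
  -- individual part
  have hfib1 : ∀ k ∈ Ioc c1 ks, m₀ ≤ y / k ∧ y / k ≤ p.W := fun k hk =>
    hfib k (Ioc_subset_Ioc_right hks2 hk)
  have E1 := indiv_err hWQ hW hks1 (hks2.trans hc2W) hfib1 (y := y) (m₀ := m₀)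
  set a := indivLoop y ((htab p.W)[m₀]!) (htab p.W) (lamBits (pattern Q) p.W) c1 ks 0 0 with ha
  simp only at E1
  -- runs part
  set r : ℤ := if ks < c2 then runsLoop y ((htab p.W)[m₀]!) 1 ks c2 (htab p.W)
      (tPre (lamBits (pattern Q) p.W) p.W) (y / c2 - 1) (y / (ks + 1)) 0 else 0 with hr
  have E2 : |(r : ℝ) - 2 ^ SR * ∑ k ∈ Ioc ks c2, fterm y m₀ k| ≤
      17 * 2 ^ SH * (c2 - ks : ℕ) + 2 ^ (ST + 1) * (Hn c2 - Hn ks) := by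
    by_cases hlt : ks < c2
    · rw [hr, if_pos hlt]
      refine runs_err hW hH hlt hc2y (fun k hk => hfib k (Ioc_subset_Ioc_left hks1 hk)) ?_
      intro kLo kHi h1 h2 h3
      rw [Nat.add_sub_cancel, Nat.add_sub_cancel,
        getElem!_of_getElem? (tPre_getElem? hWQ (h2.trans (h3.trans hc2W))),
        getElem!_of_getElem? (tPre_getElem? hWQ (h3.trans hc2W))]
    · rw [hr, if_neg hlt]
      have : ks = c2 := le_antisymm hks2 (not_lt.1 hlt)
      rw [this, Finset.Ioc_self]
      simp
  -- combine (all powers of two as numerals)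
  have p77 : (2:ℝ) ^ (SR - SH - SI) = 2 ^ 77 := by norm_num [SR, SH, SI]
  have p90 : (2:ℝ) ^ (SH + SI) = 2 ^ 90 := by norm_num [SH, SI]
  have p34 : (2:ℝ) ^ (SI + 1) = 2 ^ 34 := by norm_num [SI]
  have p111 : (2:ℝ) ^ (ST + 1) = 2 ^ 111 := by norm_num [ST]
  have p57 : (2:ℝ) ^ SH = 2 ^ 57 := by norm_num [SH]
  have p167 : (2:ℝ) ^ SR = 2 ^ 167 := by norm_num [SR]
  rw [p90, p34] at E1
  rw [p167, p57, p111] at E2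
  have hsplit : ∑ k ∈ Ioc c1 c2, fterm y m₀ k =
      ∑ k ∈ Ioc c1 ks, fterm y m₀ k + ∑ k ∈ Ioc ks c2, fterm y m₀ k :=
    (sum_Ioc_consecutive _ hks1 hks2).symm
  set X := ((a.1 : ℤ) - a.2 : ℝ) - 2 ^ 90 * ∑ k ∈ Ioc c1 ks, fterm y m₀ k with hX
  set Y := (r : ℝ) - 2 ^ 167 * ∑ k ∈ Ioc ks c2, fterm y m₀ k with hY
  have e : ((((a.1 : ℤ) - a.2) * 2 ^ (SR - SH - SI) + r : ℤ) : ℝ) - 2 ^ SR * ∑ k ∈ Ioc c1 c2, fterm y m₀ k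
      = 2 ^ 77 * X + Y := by
    rw [hsplit, p167, hX, hY]; push_cast; rw [p77]; ring
  rw [e]
  have hWr : (p.W : ℝ) < 2 ^ 33 := by exact_mod_cast hW
  have hB1 : |X| ≤ 2 ^ 33 + 2 ^ 34 * 17 := by
    refine E1.trans ?_
    have h1 : ((ks - c1 : ℕ) : ℝ) ≤ p.W := by exact_mod_cast (show ks - c1 ≤ p.W by omega)
    have h2 : Hn ks - Hn c1 ≤ 17 := by linarith [Hn_nonneg c1, Hn_mono (hks2.trans hc2W)]
    linarith
  have hB2 : |Y| ≤ 17 * 2 ^ 57 * 2 ^ 33 + 2 ^ 111 * 17 := by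
    refine E2.trans ?_
    have h1 : ((c2 - ks : ℕ) : ℝ) ≤ p.W := by exact_mod_cast (show c2 - ks ≤ p.W by omega)
    have h2 : Hn c2 - Hn ks ≤ 17 := by linarith [Hn_nonneg ks, Hn_mono hc2W]
    linarith
  calc |2 ^ 77 * X + Y| ≤ |2 ^ 77 * X| + |Y| := abs_add_le _ _
    _ = 2 ^ 77 * |X| + |Y| := by rw [abs_mul, abs_of_pos (by norm_num : (0:ℝ) < 2 ^ 77)]
    _ ≤ 2 ^ 77 * (2 ^ 33 + 2 ^ 34 * 17) + (17 * 2 ^ 57 * 2 ^ 33 + 2 ^ 111 * 17) := by linarith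
    _ ≤ smallErr := by rw [hErr]; norm_num

/-! ## The log piece of one `d` -/

/-- The cuts of a log piece: `cut i d = min kmax ⌊ℓ_i/d⌋` for `i ≤ nLog`. [folklore] -/
theorem cut_log (p : Params) {i : ℕ} (hi : i ≤ p.nLog) (d : ℕ) :
    p.cut i d = min (p.kmax d) (p.ell i / d) := by
  unfold Params.cut Params.rawCut
  rw [if_pos hi]

/-- `ℓ_{nLog} = E₀`. [folklore] -/
theorem ell_nLog (p : Params) : p.ell p.nLog = p.E0 := by
  unfold Params.ell Params.nLog
  rw [if_neg (by omega), if_neg (by omega)]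

/-- **Error of a log piece of one `d`**: with the table `hl = hlogTab p ℓ_i ℓ_{i+1}`,
`|logLoop … · 2^77 − 2^167 ∑_{cut i < k ≤ cut (i+1)} f| ≤ 2^115 (β + 2)`. [folklore] -/
theorem logD_err (p : Params) (hWQ : p.W + Q ≤ P ^ 2) (hW : p.W < 2 ^ 33) (hH : Hn p.W < 17)
    (hDW : p.D ≤ p.W) (hE0W : p.E0 ≤ p.W) (hβ : 1 ≤ p.beta) {i : ℕ} (hi : i < p.nLog)
    (hell : p.ell (i + 1) ≤ p.E0) {hl : Array ℕ} (hhl : hlogTab p (p.ell i) (p.ell (i + 1)) = some hl)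
    {d : ℕ} (hd : 1 ≤ d) :
    |((logLoop d ((htab p.W)[p.m0 d]! : ℤ) hl (lamBits (pattern Q) p.W) (p.cut i d) (p.cut (i + 1) d) 0 *
          2 ^ (SR - SH - SI) : ℤ) : ℝ) -
        2 ^ SR * ∑ k ∈ Ioc (p.cut i d) (p.cut (i + 1) d), fterm (p.y d) (p.m0 d) k| ≤ logErr p.beta := by
  have hc1 := cut_log p hi.le d
  have hc2 := cut_log p (Nat.succ_le_of_lt hi) d
  set c1 := p.cut i d with hc1d
  set c2 := p.cut (i + 1) d with hc2d
  set y := p.y d with hy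
  set m₀ := p.m0 d with hm₀
  obtain ⟨hsz, hspec⟩ := hlogTab_spec p hhl
  have hErr : (logErr p.beta : ℝ) = 2 ^ 115 * (p.beta + 2) := by rw [logErr]; push_cast; ring
  have p77 : (2:ℝ) ^ (SR - SH - SI) = 2 ^ 77 := by norm_num [SR, SH, SI]
  have p90 : (2:ℝ) ^ (SH + SI) = 2 ^ 90 := by norm_num [SH, SI]
  have p33 : (2:ℝ) ^ SI = 2 ^ 33 := by norm_num [SI]
  have p167 : (2:ℝ) ^ SR = 2 ^ 167 := by norm_num [SR]
  have hm₀W : m₀ ≤ p.W := (Nat.div_le_self _ _).trans hDW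
  by_cases hle : c2 ≤ c1
  · rw [logLoop_eq d _ hl _ (c2 - c1) c1 c2 0 rfl, Finset.Ioc_eq_empty (not_lt.2 hle)]
    simp [hErr]; positivity
  push Not at hle
  have hc2E : c2 ≤ p.ell (i + 1) / d := by rw [hc2]; exact min_le_right _ _
  have hc1E : p.ell i / d ≤ c1 := by
    rw [hc1]
    rcases Nat.lt_or_ge (p.ell i / d) (p.kmax d) with h | h
    · rw [min_eq_right h.le]
    · exfalso
      have h1 : c1 = p.kmax d := by rw [hc1]; exact min_eq_left h
      have h2 : c2 ≤ p.kmax d := by rw [hc2]; exact min_le_left _ _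
      omega
  have hc2W : c2 ≤ p.W := by
    calc c2 ≤ p.ell (i + 1) / d := hc2E
      _ ≤ p.ell (i + 1) := Nat.div_le_self _ _
      _ ≤ p.W := hell.trans hE0W
  -- the exact sum computed by the loop
  rw [logLoop_eq d _ hl _ (c2 - c1) c1 c2 0 rfl, zero_add]
  have hsum : |((∑ k' ∈ Ioc c1 c2, lamOfBit (lamBits (pattern Q) p.W) k' *
      logTerm d ((htab p.W)[m₀]! : ℤ) hl k' : ℤ) : ℝ) -
      2 ^ (SH + SI) * ∑ k ∈ Ioc c1 c2, fterm y m₀ k| ≤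
      (c2 - c1 : ℕ) + 2 ^ SI * (p.beta + 1) * (Hn c2 - Hn c1) := by
    rw [Int.cast_sum, mul_sum, ← sum_sub_distrib]
    have hcard : ((c2 - c1 : ℕ) : ℝ) = ∑ k ∈ Ioc c1 c2, (1 : ℝ) := by simp
    rw [hcard, ← sum_Ioc_inv hle.le, mul_sum, ← sum_add_distrib]
    refine (abs_sum_le_sum_abs _ _).trans (sum_le_sum fun k hk => ?_)
    obtain ⟨hk1, hk2⟩ := mem_Ioc.1 hk
    have hk0 : 0 < k := by omega
    have hkW : k ≤ p.W := hk2.trans hc2W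
    rw [lamOfBit_lamBits hWQ hk0 hkW]
    -- the table entry at `d k ∈ (ℓ_i, ℓ_{i+1}]`
    have hdk1 : p.ell i < d * k := by
      have h1 : p.ell i < p.ell i / d * d + d := Nat.lt_div_mul_add hd
      have h2 : p.ell i / d * d + d = d * (p.ell i / d + 1) := by ring
      have h3 : d * (p.ell i / d + 1) ≤ d * k := Nat.mul_le_mul_left d (by omega)
      omega
    have hdk2 : d * k ≤ p.ell (i + 1) := by
      have := Nat.mul_le_mul_left d (hk2.trans hc2E)
      exact this.trans (Nat.mul_div_le _ _)
    obtain ⟨v, hv, hok⟩ := hspec (d * k) hdk1 hdk2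
    have key := abs_logTerm_sub_le hW hk0 hm₀W hv hok hβ (N := p.N)
    have hyk : p.N / (d * k) = y / k := by rw [hy, Params.y, Nat.div_div_eq_div_mul]
    rw [hyk] at key
    rw [fterm]
    push_cast at key ⊢
    rw [mul_one_div]
    convert key using 2
  rw [p90, p33] at hsum
  set X := ((∑ k' ∈ Ioc c1 c2, lamOfBit (lamBits (pattern Q) p.W) k' *
      logTerm d ((htab p.W)[m₀]! : ℤ) hl k' : ℤ) : ℝ) - 2 ^ 90 * ∑ k ∈ Ioc c1 c2, fterm y m₀ k with hX
  have e : (((∑ k' ∈ Ioc c1 c2, lamOfBit (lamBits (pattern Q) p.W) k' *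
      logTerm d ((htab p.W)[m₀]! : ℤ) hl k') * 2 ^ (SR - SH - SI) : ℤ) : ℝ) -
      2 ^ SR * ∑ k ∈ Ioc c1 c2, fterm y m₀ k = 2 ^ 77 * X := by
    rw [hX, p167]; push_cast; rw [p77]; ring
  rw [e, abs_mul, abs_of_pos (by norm_num : (0:ℝ) < 2 ^ 77), hErr]
  have hWr : (p.W : ℝ) < 2 ^ 33 := by exact_mod_cast hW
  have hβr : (1 : ℝ) ≤ p.beta := by exact_mod_cast hβ
  have h1 : ((c2 - c1 : ℕ) : ℝ) ≤ p.W := by exact_mod_cast (show c2 - c1 ≤ p.W by omega)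
  have h2 : Hn c2 - Hn c1 ≤ 17 := by linarith [Hn_nonneg c1, Hn_mono hc2W]
  have h3 : (0 : ℝ) ≤ Hn c2 - Hn c1 := sub_nonneg.2 (Hn_mono hle.le)
  have hB : |X| ≤ 2 ^ 33 + 2 ^ 33 * (p.beta + 1) * 17 := by
    refine hsum.trans ?_
    have : (2 : ℝ) ^ 33 * (p.beta + 1) * (Hn c2 - Hn c1) ≤ 2 ^ 33 * (p.beta + 1) * 17 :=
      mul_le_mul_of_nonneg_left h2 (by positivity)
    linarith
  have hUT : (2:ℝ) ^ 115 = 2 ^ 77 * 2 ^ 33 * 32 := by norm_num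
  rw [hUT]
  have hpos : (0:ℝ) ≤ 2 ^ 77 * 2 ^ 33 := by positivity
  have hlin : (1:ℝ) + (p.beta + 1) * 17 ≤ 32 * (p.beta + 2) := by linarith
  calc (2:ℝ) ^ 77 * |X| ≤ 2 ^ 77 * (2 ^ 33 + 2 ^ 33 * (p.beta + 1) * 17) :=
        mul_le_mul_of_nonneg_left hB (by norm_num)
    _ = (2 ^ 77 * 2 ^ 33) * (1 + (p.beta + 1) * 17) := by ring
    _ ≤ (2 ^ 77 * 2 ^ 33) * (32 * (p.beta + 2)) := mul_le_mul_of_nonneg_left hlin hpos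
    _ = 2 ^ 77 * 2 ^ 33 * 32 * (p.beta + 2) := by ring

/-! ## One `d` on one sieve segment -/

/-- `H(B) − H(A) ≤ (B − A)/(A + 1)` for `A ≤ B`. [folklore] -/
theorem Hn_sub_le_div {A B : ℕ} (h : A ≤ B) : Hn B - Hn A ≤ ((B - A : ℕ) : ℝ) / (A + 1) := by
  rw [Hn_sub_Hn h]
  have hcard : ((B - A : ℕ) : ℝ) / (A + 1) = ∑ k ∈ Ioc A B, (1 : ℝ) / (A + 1) := by
    rw [sum_const, Nat.card_Ioc, nsmul_eq_mul]; ring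
  rw [hcard]
  refine sum_le_sum fun k hk => ?_
  have hk : (A : ℝ) + 1 ≤ k := by exact_mod_cast (mem_Ioc.1 hk).1
  exact one_div_le_one_div_of_le (by positivity) hk

/-- **Error of the runs of one `d` on one sieve segment** `[lo, lo + Q)` (clipped to `(tLo, tHi]` and
`kmax(d)`): the natural bound `17·2^57 (B − A) + 2^111 (H(B) − H(A))`. [folklore] -/
theorem segRuns_err (p : Params) (hW : p.W < 2 ^ 33) (hH : Hn p.W < 17) (hE0W : p.E0 ≤ p.W)
    {lo : ℕ} (hlo : Q ∣ lo) (hloP : lo + Q ≤ P ^ 2) (hlo1 : 1 ≤ lo) {tLo tHi : ℕ} (htLo : p.W ≤ tLo)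
    {d : ℕ} (hd : 1 ≤ d)
    (hAB : max tLo (lo - 1) < min (min tHi (p.kmax d)) (lo + Q - 1)) :
    |(runsLoop (p.y d) ((htab p.W)[p.m0 d]!) lo (max tLo (lo - 1)) (min (min tHi (p.kmax d)) (lo + Q - 1))
        (htab p.W) (tSeg (segSieve primesList lo (pattern Q)) lo)
        (p.y d / min (min tHi (p.kmax d)) (lo + Q - 1) - 1) (p.y d / (max tLo (lo - 1) + 1)) 0 : ℝ) -
        2 ^ SR * ∑ k ∈ Ioc (max tLo (lo - 1)) (min (min tHi (p.kmax d)) (lo + Q - 1)),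
          fterm (p.y d) (p.m0 d) k| ≤
      17 * 2 ^ SH * ((min (min tHi (p.kmax d)) (lo + Q - 1)) - max tLo (lo - 1) : ℕ) +
        2 ^ (ST + 1) * (Hn (min (min tHi (p.kmax d)) (lo + Q - 1)) - Hn (max tLo (lo - 1))) := by
  set A := max tLo (lo - 1) with hA
  set B := min (min tHi (p.kmax d)) (lo + Q - 1) with hB
  have hBk : B ≤ p.kmax d := (min_le_left _ _).trans (min_le_right _ _)
  have hBy : B ≤ p.y d := hBk.trans (kmax_le_y p d)
  refine runs_err hW hH hAB hBy (fun k hk => ?_) (fun kLo kHi h1 h2 h3 => ?_)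
  · obtain ⟨hk1, hk2⟩ := mem_Ioc.1 hk
    have hkE : p.E0 / d < k := by
      calc p.E0 / d ≤ p.E0 := Nat.div_le_self _ _
        _ ≤ tLo := hE0W.trans htLo
        _ ≤ A := le_max_left _ _
        _ < k := hk1
    have := quot_bounds p hd hkE (hk2.trans hBk)
    exact ⟨Nat.le_of_succ_le this.1, this.2⟩
  · have hkLo : lo - 1 ≤ kLo := (le_max_right _ _).trans h1
    have hkHi : kHi ≤ lo + Q - 1 := h3.trans (min_le_right _ _)
    rw [getElem!_of_getElem? (tSeg_getElem? hlo hloP hlo1 (i := kHi + 1 - lo) (by omega)),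
      getElem!_of_getElem? (tSeg_getElem? hlo hloP hlo1 (i := kLo + 1 - lo) (by omega)),
      show lo + (kHi + 1 - lo) - 1 = kHi by omega, show lo + (kLo + 1 - lo) - 1 = kLo by omega]
    ring

end Literature.Barriers.RiemannHypothesis.TuranMinWitness
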